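import Summits.BirchSwinnertonDyer.Rank1Residual.X9.TransportTorsionIso
import Literature.NumberTheory.EllipticCurves.KrausOesterle1992.TorsionCongruenceCriterionHasseWeil
import HarnessLib

/-!
# Class X9: the Kraus–Oesterlé congruence consumers RE-KEYED on the Hasse–Weil twin of Prop. 4 (generic layer; KO92 R-20 repair, step 1)

HONEST FRAMING (cell `b2b-bsdres-*`, verbatim): the cell deletes COMBINATION-SHAPED residual classes of
the rank-≤1 BSD formula from PUBLISHED theorems only and TYPES the construction-shaped remainder; this
is not "finishing BSD". Class X9 (good ordinary `p ≥ 5`, `ρ̄_{E,p}` irreducible and not surjective) stays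
TYPED at class level; everything here is PER PAIR (or generic); no lane verdict is changed; no named fact is
introduced; nothing is booked by this unit (the lane books, the referee rules). Unit `b2b-bsdres-x9`, gen 47.

## Why (the KO92 clause defect, ARM-P register R-20 `KO92-Prop4-(ii)b-frobeniusTrace-offset`, 2026-08-27)

The cited-facts audit (`pub/bsd-cited`, sheet `D-AUDIT-r07-Q41-KO92-LS18.md`) found that
`KrausOesterle1992.prop4_torsionIso_of_congruences` types Prop. 4 (ii)'s clause "`ℓ ∣ NN'`, `ℓ² ∤ NN'` ⇒
`a_ℓ a'_ℓ ≡ ℓ + 1 (mod p)`" over the tree's `frobeniusTrace`, which at the multiplicative curve of such a pair is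
`2` / `0` (`= 1 + a_ℓ`; `X11b.LocalTorsion.frobeniusTrace_eq_two_of_split` / `…_zero_of_nonsplit`), not the
Hasse–Weil `a_ℓ = ±1` the paper multiplies (Math. Ann. 293, p. 263 L8–9). Every X9 congruence-transport record displays
that list on a pair whose `N_E·N_A` has a simple prime far below `μ(M)/6` (x9 GEN 47 owner census: 35 / 35 EXPOSED),
so each is VACUOUS AS TYPED, while its two-engine certificate (Hasse–Weil `a_ℓ`) stands. The typing layer lands the
corrected twin `KrausOesterle1992.prop4_torsionIso_of_congruences_hasseWeil` (target T-Q41-1; the `= 1 →` conjunct over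
`W.LFunction ℓ * W'.LFunction ℓ`, Mathlib's `WeierstrassCurve.LFunction` having the Hasse–Weil `a_ℓ` as prime
coefficient at EVERY prime); the X9 lane re-keys its consumers on it: step 0 `X9/TransportTorsionIso.lean` (p494287,
consumers keyed on the isomorphism), step 1 `X9/TransportHasseWeil.lean` (generic), step 2 these record files.

## Contents (sorry-free; axioms standard) — one `_hasseWeil` twin per generic K–O consumer of the X9 lane

* §1 symbolic pair: `bsdp_of_bsdpPartner_of_congruences_of_partnerRank_le_one_of_irr_hasseWeil` (gen 15, `TransportPairs` §1),
  `bsdp_of_bsdpPartner_of_congruences_of_partnerRank_le_one_hasseWeil` and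
  `bsdp_of_bsdpPartner_of_conductor_lt_of_partnerRank_le_one_hasseWeil` (gen 10, `BSDpPartnerRankOne`, on `ClassX9 W p`).
* §2 integer models: `bsdp_of_ainvs_of_bsdpPartner_of_congruences_of_analyticRank_le_one_hasseWeil`,
  `bsdp_of_ainvs_of_bsdpPartner_of_congruences_hasseWeil` (rank-`0` target),
  `bsdp_of_ainvs_of_conductor_lt_of_congruences_of_analyticRank_le_one_hasseWeil` (gens 15/16, `TransportPairs` §2 /
  `TransportSweepA` §1) — one-liners over step 0's iso-keyed theorems.
The displayed list `hcong` is, conjunct for conjunct, the HYPOTHESIS of the twin (good primes: `frobeniusTrace`; simple primes: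
`LFunction`), so `KrausOesterle1992.torsionIso_of_congruences_hasseWeil hKO W A p hirr hcong` is the isomorphism.

References: Kraus–Oesterlé, Math. Ann. 293 (1992) Prop. 4; Greenberg–Vatsal, Invent. Math. 142 (2000) Thm. (1.4);
Burungale–Castella–Skinner, IMRN 2025 Thm. 1.1.2 (a); Greenberg, LNM 1716 Thm. 4.1; Perrin-Riou 1987 §1.4; Mazur 1978
Prop. 6.3 (1); Miller 2011 Thm. 1.2; Silverman AEC VII.1, C.16.
-/

set_option autoImplicit false

noncomputable section

open scoped Classical MatrixGroups ModularForm

open CongruenceSubgroup WeierstrassCurve Literature.NumberTheory.EllipticCurves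
  Literature.NumberTheory.EllipticCurves.ModularForms Literature.NumberTheory.EllipticCurves.Rank1Residual
  Literature.NumberTheory.EllipticCurves.Rank1Residual.Typed
  Literature.NumberTheory.EllipticCurves.Rank1Residual.X11RankOneCertificates
  Summit.BirchSwinnertonDyer.BirchSwinnertonDyer.Rank1Residual.IntModel
  Summit.BirchSwinnertonDyer.BirchSwinnertonDyer.Rank1Residual.X11RankOne
  Summit.BirchSwinnertonDyer.Rank1Residual.X11b

namespace Summit.BirchSwinnertonDyer.Rank1Residual.X9

/-! ### §1. Symbolic pair `(W, A)` -/

section Generic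

variable (W A : WeierstrassCurve ℚ) [W.IsElliptic] [W.IsGloballyMinimal] [A.IsElliptic]
  [A.IsGloballyMinimal] (p : ℕ) [Fact p.Prime]

/-- **Route U2′ (partner of analytic rank `≤ 1`), target hypotheses unpacked, C1 = the Kraus–Oesterlé list IN HASSE–WEIL
CURRENCY** — gen 15's `bsdp_of_bsdpPartner_of_congruences_of_partnerRank_le_one_of_irr` re-keyed: `hKO` is the corrected
statement `KrausOesterle1992.prop4_torsionIso_of_congruences_hasseWeil` and the `v_ℓ(NN') = 1` conjunct of `hcong` reads
`a_ℓ(E)·a_ℓ(A) ≡ ℓ + 1 (mod p)` with the HASSE–WEIL coefficients `W.LFunction ℓ`, `A.LFunction ℓ` (`= ±1` at the multiplicative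
curve; Kraus–Oesterlé p. 263 L8–9), the good-prime conjunct unchanged (`frobeniusTrace`, which IS the Hasse–Weil `a_ℓ` at a prime good for both curves — `LFunction_apply_prime_eq_frobeniusTrace`). Proof: the twin's forwarder
`torsionIso_of_congruences_hasseWeil` gives C1 as an isomorphism, then gen 15's iso-keyed
`bsdp_of_bsdpPartner_of_partnerRank_le_one_of_irr`. [cite: KrausOesterle1992, Prop. 4 (ii), pp. 263–264]
[cite: GreenbergVatsal2000, Thm. (1.4) (arXiv p. 5)] [cite: BurungaleCastellaSkinner2025, Thm. 1.1.2 (a) (p. 2 of arXiv:2405.00270v2)] -/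
theorem bsdp_of_bsdpPartner_of_congruences_of_partnerRank_le_one_of_irr_hasseWeil
    (hKO : KrausOesterle1992.prop4_torsionIso_of_congruences_hasseWeil)
    (hBCS : burungale_castella_skinner_charIdeal_eq_padicLFunction)
    (hGr : greenberg_charValue_rankZero) (h5 : realPeriodRat_eq_unit_mul_plusPeriod)
    (hGV : GreenbergVatsal2000.thm14_mainConjecture_transfer_of_torsionIso)
    (hS : Schneider1985_order_charGenerator) (hPR : perrinRiou_rankOne_leadingTerms)
    (hmodP : nonempty_modularParametrizationData) (hmodL : hasEntireLFunction_rat)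
    (hGZK : rank_eq_analyticRank_of_analyticRank_le_one)
    (hran : W.analyticRank ≤ 1) (hgood : W.HasGoodReductionAtPrime p)
    (hord : ¬ (p : ℤ) ∣ W.frobeniusTrace p) (hp : 5 ≤ p) (hirr : W.HasIrreducibleModPGaloisRep p)
    (hgoodA : A.HasGoodReductionAtPrime p) (hordA : ¬ (p : ℤ) ∣ A.frobeniusTrace p)
    (hrA : A.analyticRank ≤ 1) (hbsdA : BSDp A p)
    (hSchA : A.analyticRank = 1 → ∀ Dh : PAdicHeightData A p, Dh.IsCanonical → SchneiderConjecture Dh)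
    (hcertA : ∀ [NeZero (A.conductorNorm ℤ)] (fA : CuspForm (Gamma0 (A.conductorNorm ℤ)) 2),
        IsNewformOf A fA → ∀ (ϖ : ℚ), (ϖ : ℝ) * A.realPeriodRat = plusPeriod fA →
      ∃ n : ℕ, ‖PowerSeries.coeff n
        (PowerSeries.C (ϖ : ℚ_[p]) * padicLFunction fA (unitRoot A p : ℚ_[p]))‖ = 1)
    (hcong : ∀ (ℓ : ℕ) [Fact ℓ.Prime],
      6 * ℓ < KrausOesterle1992.gammaZeroIndex (KrausOesterle1992.modulus W A) →
      (padicValNat ℓ (W.conductorNorm ℤ * A.conductorNorm ℤ) = 0 →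
          (p : ℤ) ∣ W.frobeniusTrace ℓ - A.frobeniusTrace ℓ) ∧
        (padicValNat ℓ (W.conductorNorm ℤ * A.conductorNorm ℤ) = 1 →
          (p : ℤ) ∣ W.LFunction ℓ * A.LFunction ℓ - (ℓ + 1)))
    (hC3 : W.analyticRank = 1 → ∀ Dh : PAdicHeightData W p, Dh.IsCanonical → SchneiderConjecture Dh) :
    BSDp W p :=
  bsdp_of_bsdpPartner_of_partnerRank_le_one_of_irr W A p hBCS hGr h5 hGV hS hPR hmodP hmodL hGZK hran
    hgood hord hp hirr hgoodA hordA hrA hbsdA hSchA hcertA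
    (KrausOesterle1992.torsionIso_of_congruences_hasseWeil hKO W A p hirr hcong) hC3

/-- **Route U2′ (partner of analytic rank `≤ 1`) on the class predicate `ClassX9 W p`, C1 = the Kraus–Oesterlé list in
Hasse–Weil currency** — gen 10's `bsdp_of_bsdpPartner_of_congruences_of_partnerRank_le_one` re-keyed on the twin.
[cite: KrausOesterle1992, Prop. 4 (ii), pp. 263–264] [cite: GreenbergVatsal2000, Thm. (1.4) (arXiv p. 5)] -/
theorem bsdp_of_bsdpPartner_of_congruences_of_partnerRank_le_one_hasseWeil
    (hKO : KrausOesterle1992.prop4_torsionIso_of_congruences_hasseWeil)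
    (hBCS : burungale_castella_skinner_charIdeal_eq_padicLFunction)
    (hGr : greenberg_charValue_rankZero) (h5 : realPeriodRat_eq_unit_mul_plusPeriod)
    (hGV : GreenbergVatsal2000.thm14_mainConjecture_transfer_of_torsionIso)
    (hS : Schneider1985_order_charGenerator) (hPR : perrinRiou_rankOne_leadingTerms)
    (hmodP : nonempty_modularParametrizationData) (hmodL : hasEntireLFunction_rat)
    (hGZK : rank_eq_analyticRank_of_analyticRank_le_one)
    (hran : W.analyticRank ≤ 1) (hX9 : ClassX9 W p)
    (hgoodA : A.HasGoodReductionAtPrime p) (hordA : ¬ (p : ℤ) ∣ A.frobeniusTrace p)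
    (hrA : A.analyticRank ≤ 1) (hbsdA : BSDp A p)
    (hSchA : A.analyticRank = 1 → ∀ Dh : PAdicHeightData A p, Dh.IsCanonical → SchneiderConjecture Dh)
    (hcertA : ∀ [NeZero (A.conductorNorm ℤ)] (fA : CuspForm (Gamma0 (A.conductorNorm ℤ)) 2),
        IsNewformOf A fA → ∀ (ϖ : ℚ), (ϖ : ℝ) * A.realPeriodRat = plusPeriod fA →
      ∃ n : ℕ, ‖PowerSeries.coeff n
        (PowerSeries.C (ϖ : ℚ_[p]) * padicLFunction fA (unitRoot A p : ℚ_[p]))‖ = 1)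
    (hcong : ∀ (ℓ : ℕ) [Fact ℓ.Prime],
      6 * ℓ < KrausOesterle1992.gammaZeroIndex (KrausOesterle1992.modulus W A) →
      (padicValNat ℓ (W.conductorNorm ℤ * A.conductorNorm ℤ) = 0 →
          (p : ℤ) ∣ W.frobeniusTrace ℓ - A.frobeniusTrace ℓ) ∧
        (padicValNat ℓ (W.conductorNorm ℤ * A.conductorNorm ℤ) = 1 →
          (p : ℤ) ∣ W.LFunction ℓ * A.LFunction ℓ - (ℓ + 1)))
    (hC3 : W.analyticRank = 1 → ∀ Dh : PAdicHeightData W p, Dh.IsCanonical → SchneiderConjecture Dh) :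
    BSDp W p := by
  obtain ⟨-, -, -, hirr, -, -⟩ := id hX9
  exact bsdp_of_bsdpPartner_of_partnerRank_le_one W A p hBCS hGr h5 hGV hS hPR hmodP hmodL hGZK hran
    hX9 hgoodA hordA hrA hbsdA hSchA hcertA
    (KrausOesterle1992.torsionIso_of_congruences_hasseWeil hKO W A p hirr hcong) hC3

/-- **Route U2′ on `ClassX9 W p` with a partner of conductor `< 5000` (`BSD(A,p)` by Miller 2011 / Creutz–Miller 2012,
`hMiller`), C1 = the Kraus–Oesterlé list in Hasse–Weil currency** — gen 10's
`bsdp_of_bsdpPartner_of_conductor_lt_of_partnerRank_le_one` re-keyed on the twin. [cite: Miller2011LMS, Thm. 1.2]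
[cite: KrausOesterle1992, Prop. 4 (ii), pp. 263–264] [cite: GreenbergVatsal2000, Thm. (1.4) (arXiv p. 5)] -/
theorem bsdp_of_bsdpPartner_of_conductor_lt_of_partnerRank_le_one_hasseWeil
    (hKO : KrausOesterle1992.prop4_torsionIso_of_congruences_hasseWeil)
    (hMiller : bsdp_of_irreducible_of_conductor_lt)
    (hBCS : burungale_castella_skinner_charIdeal_eq_padicLFunction)
    (hGr : greenberg_charValue_rankZero) (h5 : realPeriodRat_eq_unit_mul_plusPeriod)
    (hGV : GreenbergVatsal2000.thm14_mainConjecture_transfer_of_torsionIso)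
    (hS : Schneider1985_order_charGenerator) (hPR : perrinRiou_rankOne_leadingTerms)
    (hmodP : nonempty_modularParametrizationData) (hmodL : hasEntireLFunction_rat)
    (hGZK : rank_eq_analyticRank_of_analyticRank_le_one)
    (hran : W.analyticRank ≤ 1) (hX9 : ClassX9 W p)
    (hgoodA : A.HasGoodReductionAtPrime p) (hordA : ¬ (p : ℤ) ∣ A.frobeniusTrace p)
    (hrA : A.analyticRank ≤ 1) (hNA : A.conductorNorm ℤ < 5000)
    (hSchA : A.analyticRank = 1 → ∀ Dh : PAdicHeightData A p, Dh.IsCanonical → SchneiderConjecture Dh)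
    (hcertA : ∀ [NeZero (A.conductorNorm ℤ)] (fA : CuspForm (Gamma0 (A.conductorNorm ℤ)) 2),
        IsNewformOf A fA → ∀ (ϖ : ℚ), (ϖ : ℝ) * A.realPeriodRat = plusPeriod fA →
      ∃ n : ℕ, ‖PowerSeries.coeff n
        (PowerSeries.C (ϖ : ℚ_[p]) * padicLFunction fA (unitRoot A p : ℚ_[p]))‖ = 1)
    (hcong : ∀ (ℓ : ℕ) [Fact ℓ.Prime],
      6 * ℓ < KrausOesterle1992.gammaZeroIndex (KrausOesterle1992.modulus W A) →
      (padicValNat ℓ (W.conductorNorm ℤ * A.conductorNorm ℤ) = 0 →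
          (p : ℤ) ∣ W.frobeniusTrace ℓ - A.frobeniusTrace ℓ) ∧
        (padicValNat ℓ (W.conductorNorm ℤ * A.conductorNorm ℤ) = 1 →
          (p : ℤ) ∣ W.LFunction ℓ * A.LFunction ℓ - (ℓ + 1)))
    (hC3 : W.analyticRank = 1 → ∀ Dh : PAdicHeightData W p, Dh.IsCanonical → SchneiderConjecture Dh) :
    BSDp W p := by
  obtain ⟨-, -, -, hirr, -, -⟩ := id hX9
  obtain ⟨e, he⟩ := KrausOesterle1992.torsionIso_of_congruences_hasseWeil hKO W A p hirr hcong
  have hirrA : A.HasIrreducibleModPGaloisRep p :=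
    hasIrreducibleModPGaloisRep_of_torsionIso_symm e he hirr
  exact bsdp_of_bsdpPartner_of_partnerRank_le_one W A p hBCS hGr h5 hGV hS hPR hmodP hmodL hGZK hran
    hX9 hgoodA hordA hrA (hMiller A hrA hNA p Fact.out hirrA) hSchA hcertA ⟨e, he⟩ hC3

end Generic

/-! ### §2. Integer models (kernel-decided Galois / reduction data) -/

/-- **Target of analytic rank `≤ 1`, partner of analytic rank `≤ 1`, integer models, C1 = the Kraus–Oesterlé list in
Hasse–Weil currency** — gen 16's `bsdp_of_ainvs_of_bsdpPartner_of_congruences_of_analyticRank_le_one` re-keyed: `E[p]`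
irreducible from the Frobenius witness (gen 47's packaged `hasGoodReductionAtPrime_and_not_dvd_and_irr_of_ainvs`), the twin's
forwarder turns `hcong` into the isomorphism, then gen 47's iso-keyed
`bsdp_of_ainvs_of_bsdpPartner_of_torsionIso_of_analyticRank_le_one`. [cite: KrausOesterle1992, Prop. 4 (ii), pp. 263–264]
[cite: GreenbergVatsal2000, Thm. (1.4) (arXiv p. 5)] [cite: Mazur1978, §6 Prop. 6.3 (1) (p. 153)] -/
theorem bsdp_of_ainvs_of_bsdpPartner_of_congruences_of_analyticRank_le_one_hasseWeil
    (hKO : KrausOesterle1992.prop4_torsionIso_of_congruences_hasseWeil)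
    (hBCS : burungale_castella_skinner_charIdeal_eq_padicLFunction)
    (hGr : greenberg_charValue_rankZero) (h5 : realPeriodRat_eq_unit_mul_plusPeriod)
    (hGV : GreenbergVatsal2000.thm14_mainConjecture_transfer_of_torsionIso)
    (hS : Schneider1985_order_charGenerator) (hPR : perrinRiou_rankOne_leadingTerms)
    (hmodP : nonempty_modularParametrizationData) (hmodL : hasEntireLFunction_rat)
    (hGZK : rank_eq_analyticRank_of_analyticRank_le_one)
    (a1 a2 a3 a4 a6 : ℤ) {W : WeierstrassCurve ℚ} [W.IsElliptic] [W.IsGloballyMinimal]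
    (hW : integralModelInt W = ⟨a1, a2, a3, a4, a6⟩)
    (b1 b2 b3 b4 b6 : ℤ) {A : WeierstrassCurve ℚ} [A.IsElliptic] [A.IsGloballyMinimal]
    (hA : integralModelInt A = ⟨b1, b2, b3, b4, b6⟩)
    (p ℓ n np npA : ℕ) [Fact p.Prime] [Fact ℓ.Prime] (hp : 5 ≤ p)
    (hpΔ : ¬ (p : ℤ) ∣ discOf [a1, a2, a3, a4, a6])
    (hcardp : Nat.card (((⟨a1, a2, a3, a4, a6⟩ : WeierstrassCurve ℤ).map
      (Int.castRingHom (ZMod p))).toAffine.Point) = np)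
    (hordp : ¬ (p : ℤ) ∣ (p : ℤ) + 1 - np)
    (hℓp : ℓ ≠ p) (hℓΔ : ¬ (ℓ : ℤ) ∣ discOf [a1, a2, a3, a4, a6])
    (hcard : Nat.card (((⟨a1, a2, a3, a4, a6⟩ : WeierstrassCurve ℤ).map
      (Int.castRingHom (ZMod ℓ))).toAffine.Point) = n)
    (hnoroot : ∀ t : ℕ, t < p → ¬ (p : ℤ) ∣ (t : ℤ) ^ 2 - ((ℓ : ℤ) + 1 - n) * t + ℓ)
    (hpΔA : ¬ (p : ℤ) ∣ discOf [b1, b2, b3, b4, b6])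
    (hcardpA : Nat.card (((⟨b1, b2, b3, b4, b6⟩ : WeierstrassCurve ℤ).map
      (Int.castRingHom (ZMod p))).toAffine.Point) = npA)
    (hordpA : ¬ (p : ℤ) ∣ (p : ℤ) + 1 - npA)
    (hran : W.analyticRank ≤ 1) (hrA : A.analyticRank ≤ 1) (hbsdA : BSDp A p)
    (hSchA : A.analyticRank = 1 → ∀ Dh : PAdicHeightData A p, Dh.IsCanonical → SchneiderConjecture Dh)
    (hcertA : ∀ [NeZero (A.conductorNorm ℤ)] (fA : CuspForm (Gamma0 (A.conductorNorm ℤ)) 2),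
        IsNewformOf A fA → ∀ (ϖ : ℚ), (ϖ : ℝ) * A.realPeriodRat = plusPeriod fA →
      ∃ n : ℕ, ‖PowerSeries.coeff n
        (PowerSeries.C (ϖ : ℚ_[p]) * padicLFunction fA (unitRoot A p : ℚ_[p]))‖ = 1)
    (hcong : ∀ (ℓ : ℕ) [Fact ℓ.Prime],
      6 * ℓ < KrausOesterle1992.gammaZeroIndex (KrausOesterle1992.modulus W A) →
      (padicValNat ℓ (W.conductorNorm ℤ * A.conductorNorm ℤ) = 0 →
          (p : ℤ) ∣ W.frobeniusTrace ℓ - A.frobeniusTrace ℓ) ∧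
        (padicValNat ℓ (W.conductorNorm ℤ * A.conductorNorm ℤ) = 1 →
          (p : ℤ) ∣ W.LFunction ℓ * A.LFunction ℓ - (ℓ + 1)))
    (hC3 : W.analyticRank = 1 → ∀ Dh : PAdicHeightData W p, Dh.IsCanonical → SchneiderConjecture Dh) :
    BSDp W p := by
  obtain ⟨-, -, hirr⟩ := hasGoodReductionAtPrime_and_not_dvd_and_irr_of_ainvs a1 a2 a3 a4 a6 hW p ℓ n np hpΔ
    hcardp hordp hℓp hℓΔ hcard hnoroot
  exact bsdp_of_ainvs_of_bsdpPartner_of_torsionIso_of_analyticRank_le_one hBCS hGr h5 hGV hS hPR hmodP hmodL hGZK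
    a1 a2 a3 a4 a6 hW b1 b2 b3 b4 b6 hA p ℓ n np npA hp hpΔ hcardp hordp hℓp hℓΔ hcard hnoroot hpΔA hcardpA hordpA
    hran hrA hbsdA hSchA hcertA (KrausOesterle1992.torsionIso_of_congruences_hasseWeil hKO W A p hirr hcong) hC3

/-- **The same for a target of analytic rank `0`** — gen 15's `bsdp_of_ainvs_of_bsdpPartner_of_congruences` re-keyed on the
twin. [cite: KrausOesterle1992, Prop. 4 (ii), pp. 263–264] [cite: GreenbergVatsal2000, Thm. (1.4) (arXiv p. 5)]
[cite: GreenbergLNM1716, Thm. 4.1 (p. 102)] -/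
theorem bsdp_of_ainvs_of_bsdpPartner_of_congruences_hasseWeil
    (hKO : KrausOesterle1992.prop4_torsionIso_of_congruences_hasseWeil)
    (hBCS : burungale_castella_skinner_charIdeal_eq_padicLFunction)
    (hGr : greenberg_charValue_rankZero) (h5 : realPeriodRat_eq_unit_mul_plusPeriod)
    (hGV : GreenbergVatsal2000.thm14_mainConjecture_transfer_of_torsionIso)
    (hS : Schneider1985_order_charGenerator) (hPR : perrinRiou_rankOne_leadingTerms)
    (hmodP : nonempty_modularParametrizationData) (hmodL : hasEntireLFunction_rat)
    (hGZK : rank_eq_analyticRank_of_analyticRank_le_one)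
    (a1 a2 a3 a4 a6 : ℤ) {W : WeierstrassCurve ℚ} [W.IsElliptic] [W.IsGloballyMinimal]
    (hW : integralModelInt W = ⟨a1, a2, a3, a4, a6⟩)
    (b1 b2 b3 b4 b6 : ℤ) {A : WeierstrassCurve ℚ} [A.IsElliptic] [A.IsGloballyMinimal]
    (hA : integralModelInt A = ⟨b1, b2, b3, b4, b6⟩)
    (p ℓ n np npA : ℕ) [Fact p.Prime] [Fact ℓ.Prime] (hp : 5 ≤ p)
    (hpΔ : ¬ (p : ℤ) ∣ discOf [a1, a2, a3, a4, a6])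
    (hcardp : Nat.card (((⟨a1, a2, a3, a4, a6⟩ : WeierstrassCurve ℤ).map
      (Int.castRingHom (ZMod p))).toAffine.Point) = np)
    (hordp : ¬ (p : ℤ) ∣ (p : ℤ) + 1 - np)
    (hℓp : ℓ ≠ p) (hℓΔ : ¬ (ℓ : ℤ) ∣ discOf [a1, a2, a3, a4, a6])
    (hcard : Nat.card (((⟨a1, a2, a3, a4, a6⟩ : WeierstrassCurve ℤ).map
      (Int.castRingHom (ZMod ℓ))).toAffine.Point) = n)
    (hnoroot : ∀ t : ℕ, t < p → ¬ (p : ℤ) ∣ (t : ℤ) ^ 2 - ((ℓ : ℤ) + 1 - n) * t + ℓ)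
    (hpΔA : ¬ (p : ℤ) ∣ discOf [b1, b2, b3, b4, b6])
    (hcardpA : Nat.card (((⟨b1, b2, b3, b4, b6⟩ : WeierstrassCurve ℤ).map
      (Int.castRingHom (ZMod p))).toAffine.Point) = npA)
    (hordpA : ¬ (p : ℤ) ∣ (p : ℤ) + 1 - npA)
    (hr : W.analyticRank = 0) (hrA : A.analyticRank ≤ 1) (hbsdA : BSDp A p)
    (hSchA : A.analyticRank = 1 → ∀ Dh : PAdicHeightData A p, Dh.IsCanonical → SchneiderConjecture Dh)
    (hcertA : ∀ [NeZero (A.conductorNorm ℤ)] (fA : CuspForm (Gamma0 (A.conductorNorm ℤ)) 2),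
        IsNewformOf A fA → ∀ (ϖ : ℚ), (ϖ : ℝ) * A.realPeriodRat = plusPeriod fA →
      ∃ n : ℕ, ‖PowerSeries.coeff n
        (PowerSeries.C (ϖ : ℚ_[p]) * padicLFunction fA (unitRoot A p : ℚ_[p]))‖ = 1)
    (hcong : ∀ (ℓ : ℕ) [Fact ℓ.Prime],
      6 * ℓ < KrausOesterle1992.gammaZeroIndex (KrausOesterle1992.modulus W A) →
      (padicValNat ℓ (W.conductorNorm ℤ * A.conductorNorm ℤ) = 0 →
          (p : ℤ) ∣ W.frobeniusTrace ℓ - A.frobeniusTrace ℓ) ∧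
        (padicValNat ℓ (W.conductorNorm ℤ * A.conductorNorm ℤ) = 1 →
          (p : ℤ) ∣ W.LFunction ℓ * A.LFunction ℓ - (ℓ + 1))) :
    BSDp W p :=
  bsdp_of_ainvs_of_bsdpPartner_of_congruences_of_analyticRank_le_one_hasseWeil hKO hBCS hGr h5 hGV hS hPR hmodP
    hmodL hGZK a1 a2 a3 a4 a6 hW b1 b2 b3 b4 b6 hA p ℓ n np npA hp hpΔ hcardp hordp hℓp hℓΔ hcard hnoroot hpΔA hcardpA
    hordpA (by rw [hr]; norm_num) hrA hbsdA hSchA hcertA hcong (fun h1 ↦ absurd h1 (by rw [hr]; norm_num))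

/-- **Partner of conductor `< 5000`, `BSD(A,p)` DISCHARGED by Miller 2011 / Creutz–Miller 2012 (`hMiller`), integer models, C1
= the Kraus–Oesterlé list in Hasse–Weil currency** — gen 16's
`bsdp_of_ainvs_of_conductor_lt_of_congruences_of_analyticRank_le_one` re-keyed on the twin. [cite: Miller2011LMS, Thm. 1.2]
[cite: KrausOesterle1992, Prop. 4 (ii), pp. 263–264] [cite: GreenbergVatsal2000, Thm. (1.4) (arXiv p. 5)] -/
theorem bsdp_of_ainvs_of_conductor_lt_of_congruences_of_analyticRank_le_one_hasseWeil
    (hKO : KrausOesterle1992.prop4_torsionIso_of_congruences_hasseWeil)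
    (hMiller : bsdp_of_irreducible_of_conductor_lt)
    (hBCS : burungale_castella_skinner_charIdeal_eq_padicLFunction)
    (hGr : greenberg_charValue_rankZero) (h5 : realPeriodRat_eq_unit_mul_plusPeriod)
    (hGV : GreenbergVatsal2000.thm14_mainConjecture_transfer_of_torsionIso)
    (hS : Schneider1985_order_charGenerator) (hPR : perrinRiou_rankOne_leadingTerms)
    (hmodP : nonempty_modularParametrizationData) (hmodL : hasEntireLFunction_rat)
    (hGZK : rank_eq_analyticRank_of_analyticRank_le_one)
    (a1 a2 a3 a4 a6 : ℤ) {W : WeierstrassCurve ℚ} [W.IsElliptic] [W.IsGloballyMinimal]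
    (hW : integralModelInt W = ⟨a1, a2, a3, a4, a6⟩)
    (b1 b2 b3 b4 b6 : ℤ) {A : WeierstrassCurve ℚ} [A.IsElliptic] [A.IsGloballyMinimal]
    (hA : integralModelInt A = ⟨b1, b2, b3, b4, b6⟩)
    (p ℓ n np npA : ℕ) [Fact p.Prime] [Fact ℓ.Prime] (hp : 5 ≤ p)
    (hpΔ : ¬ (p : ℤ) ∣ discOf [a1, a2, a3, a4, a6])
    (hcardp : Nat.card (((⟨a1, a2, a3, a4, a6⟩ : WeierstrassCurve ℤ).map
      (Int.castRingHom (ZMod p))).toAffine.Point) = np)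
    (hordp : ¬ (p : ℤ) ∣ (p : ℤ) + 1 - np)
    (hℓp : ℓ ≠ p) (hℓΔ : ¬ (ℓ : ℤ) ∣ discOf [a1, a2, a3, a4, a6])
    (hcard : Nat.card (((⟨a1, a2, a3, a4, a6⟩ : WeierstrassCurve ℤ).map
      (Int.castRingHom (ZMod ℓ))).toAffine.Point) = n)
    (hnoroot : ∀ t : ℕ, t < p → ¬ (p : ℤ) ∣ (t : ℤ) ^ 2 - ((ℓ : ℤ) + 1 - n) * t + ℓ)
    (hpΔA : ¬ (p : ℤ) ∣ discOf [b1, b2, b3, b4, b6])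
    (hcardpA : Nat.card (((⟨b1, b2, b3, b4, b6⟩ : WeierstrassCurve ℤ).map
      (Int.castRingHom (ZMod p))).toAffine.Point) = npA)
    (hordpA : ¬ (p : ℤ) ∣ (p : ℤ) + 1 - npA)
    (hran : W.analyticRank ≤ 1) (hrA : A.analyticRank ≤ 1) (hNA : A.conductorNorm ℤ < 5000)
    (hSchA : A.analyticRank = 1 → ∀ Dh : PAdicHeightData A p, Dh.IsCanonical → SchneiderConjecture Dh)
    (hcertA : ∀ [NeZero (A.conductorNorm ℤ)] (fA : CuspForm (Gamma0 (A.conductorNorm ℤ)) 2),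
        IsNewformOf A fA → ∀ (ϖ : ℚ), (ϖ : ℝ) * A.realPeriodRat = plusPeriod fA →
      ∃ n : ℕ, ‖PowerSeries.coeff n
        (PowerSeries.C (ϖ : ℚ_[p]) * padicLFunction fA (unitRoot A p : ℚ_[p]))‖ = 1)
    (hcong : ∀ (ℓ : ℕ) [Fact ℓ.Prime],
      6 * ℓ < KrausOesterle1992.gammaZeroIndex (KrausOesterle1992.modulus W A) →
      (padicValNat ℓ (W.conductorNorm ℤ * A.conductorNorm ℤ) = 0 →
          (p : ℤ) ∣ W.frobeniusTrace ℓ - A.frobeniusTrace ℓ) ∧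
        (padicValNat ℓ (W.conductorNorm ℤ * A.conductorNorm ℤ) = 1 →
          (p : ℤ) ∣ W.LFunction ℓ * A.LFunction ℓ - (ℓ + 1)))
    (hC3 : W.analyticRank = 1 → ∀ Dh : PAdicHeightData W p, Dh.IsCanonical → SchneiderConjecture Dh) :
    BSDp W p := by
  obtain ⟨-, -, hirr⟩ := hasGoodReductionAtPrime_and_not_dvd_and_irr_of_ainvs a1 a2 a3 a4 a6 hW p ℓ n np hpΔ
    hcardp hordp hℓp hℓΔ hcard hnoroot
  exact bsdp_of_ainvs_of_conductor_lt_of_torsionIso_of_analyticRank_le_one hMiller hBCS hGr h5 hGV hS hPR hmodP hmodL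
    hGZK a1 a2 a3 a4 a6 hW b1 b2 b3 b4 b6 hA p ℓ n np npA hp hpΔ hcardp hordp hℓp hℓΔ hcard hnoroot hpΔA hcardpA hordpA
    hran hrA hNA hSchA hcertA (KrausOesterle1992.torsionIso_of_congruences_hasseWeil hKO W A p hirr hcong) hC3

end Summit.BirchSwinnertonDyer.Rank1Residual.X9

end
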